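import Literature.Topology.FourManifolds.TrisectionStabilizationDatum
import Literature.Topology.FourManifolds.TrisectionFunctorGKInputs
import Literature.Topology.FourManifolds.TrisectionsJointChart
import Literature.Topology.FourManifolds.SphereTrisectionsSectors
import Literature.AlgebraicTopology.FundamentalGroup.CellAttachmentKernelLoop
import Literature.AlgebraicTopology.FundamentalGroup.SphereSimplyConnected
import HarnessLib

/-!
# The genus-`0` free-basis datum: a disc in the central `2`-sphere of Gay–Kirby's trisection
# of `S⁴`

Topic `Literature/Topology/FourManifolds`; fact seat
`provefact-Literature.Topology.FourManifolds.sphere-99d675ea90` (named fact (d′)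
`Literature.Topology.FourManifolds.sphere_gkTrisections`, `TrisectionFunctorGK.lean`).  Everything
in this file is **proved**; there are no definitions and no named facts.

`TrisectionStabilizationDatum.lean` reduces (d′) — the standard `(3 + 3m, 1 + m)`-trisections of
the round `S⁴` (Gay–Kirby 2016, §2: "Stabilizing the genus `0` trisection of `S⁴` gives a genus `3`
trisection", iterated) — to an ON-THE-NOSE stabilisation step
(`sphere_gkTrisections_of_invariant_step`) acting on marked trisections carrying a **free-basis
datum** on the central surface `F`: a closed disc `D ⊆ F`, `A = F ∖ D̊`, the seam circle
`C = ∂D ∋ x₀` with a collar `C_A = A ∩ O_A` in `A` strong deformation retracting onto `C`, a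
generator `t` of `π₁(C, x₀)`, a free basis `θ_A : F⟨a₁, …, b_g⟩ ≃* π₁(A, x₀)` with `θ_A(r_g) = t`,
and the marking reading through it — hypotheses `hA, hCA, hOA, hCAe, hCCA, hsdrCA, hApc, hCpc,
hx₀, hAF, t, ht, θA, hθA, μ₀, hμ₀` of
`Literature.Topology.FourManifolds.exists_marking_groupGKTrisectionOf_eq_stabilize` and of
`Literature.Topology.FourManifolds.exists_marking_groupGKTrisectionOf_eq_stabilize_datum`.
The induction starts from Gay–Kirby's genus-`0` trisection of `S⁴`
(`Literature.Topology.FourManifolds.GayKirby.sphereSector`, central surface the round `2`-sphere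
`{z = 0} ∩ S⁴`, Gay–Kirby 2016, §2, first example: "The diagram is `S²` with no curves").  This
file supplies the **base case**: the datum at genus `0`, for ANY closed disc in the central
`2`-sphere presented by a chart-like `2`-cell.

* `diff_image_ball_eq_union`, `isClosed_diff_image_ball`, `diff_image_ball_inter_eq`,
  `image_sphere_subset_diff_image_ball` — set algebra of a chart-like `2`-cell
  `Φ : B̄(0, 2) ⊂ ℝ² → X` (continuous, injective, `F ∩ O = Φ(B(0, 2))` for an open `O`) in a
  closed `F`: `A = F ∖ Φ(B(0,1))` is closed, `A ∩ O = Φ(1 ≤ ‖z‖ < 2)`, `C = Φ(‖z‖ = 1) ⊆ A`;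
* `isStrongDeformationRetractOf_sphere_halfOpenAnnulus` — in a real normed space the sphere
  `‖z‖ = a` is a strong deformation retract of `a ≤ ‖z‖ < b` (radial deformation, Hatcher Ch. 0
  p. 2), and `isStrongDeformationRetractOf_image_sphere_collar` — its transport along `Φ`:
  the collar `Φ(1 ≤ ‖z‖ < 2)` strong deformation retracts onto `C`;
* `isSimplyConnected_diff_image_ball` — if `F ∖ {Φ 0}` is simply connected then so is `A`
  (Hatcher, proof of Prop. 1.26: `A` is a deformation retract of `F ∖ {Φ 0}`,
  `isSimplyConnected_union_range_diff_singleton_iff`), `isPathConnected_image_sphere` (`C` is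
  path connected), and `exists_closure_singleton_eq_top_image_sphere` — `π₁(C, x₀)` is cyclic
  at every `x₀ ∈ C` (Hatcher Thm. 1.7 via `zpowers_liftPath_eq_top_of_simpleClosed`);
* `surjective_inclHomOfSubset_diff_image_ball` (`π₁(A) ↠ π₁(F)`: one `2`-cell, Hatcher
  Prop. 1.26 (a)), `surjective_inclHomOfSubset_of_surjective_of_injective` (pure bookkeeping) and
  `IsGKTrisection.surjective_inclHomOfSubset_diff_image_ball_bite` — **hypothesis `hsAH` of the
  stabilisation step at every genus**: for a Gay–Kirby trisection, `π₁(A) → π₁(A^H)` is onto for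
  any `A ⊆ A^H ⊆ Hᵢ` injecting into `π₁(Hᵢ)` (the handlebody minus a half-ball bite), by
  `π₁(A) ↠ π₁(F) ↠ π₁(Hᵢ)` (`IsGKTrisection.surjective_inclHomOfSubset_handlebody`);
* `exists_datum_genus_zero_of_cell` — **the genus-`0` datum of a chart-like `2`-cell in a
  closed `F` with `F ∖ {Φ 0}` simply connected**, in the binder shape of the stabilisation step;
* `exists_chartCell_of_chart` — a local homeomorphism `Θ` onto an open set of `ℝ⁴` with
  `Θ x = 0` and `F ∩ Θ.source = {q₀ = q₁ = 0}` yields the chart-like `2`-cell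
  `Φ(z) = Θ⁻¹(0, 0, ρ z)` in `F` centred at `x` (`F ∩ O = Φ(B(0,2))` for
  `O = {‖(Θ y)₂₃‖ < 2ρ}`), and `IsGKTrisection.exists_jointChart_cell` — the same cell read in a
  joint chart of a Gay–Kirby trisection (`IsGKTrisection.exists_jointChart`) at any point of
  the central surface, at every genus;
* `GayKirby.isClosed_iInter_sphereSector`, `GayKirby.isSimplyConnected_iInter_sphereSector_diff_singleton`
  — the central surface `{z = 0} ∩ S⁴ ≅ S²` of the genus-`0` trisection is closed and stays
  simply connected after removing any point (stereographic projection, Hatcher Prop. 1.14);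
* `GayKirby.sphereSector_exists_datum` — **the base case of the datum induction for (d′)**: every
  chart-like `2`-cell in the central `2`-sphere of `GayKirby.sphereSector`, with any base point on
  its boundary circle, carries the full genus-`0` datum `(A, C, C_A, t, θ_A, μ₀)` with
  `θ_A(r_0) = t` read in `A` and `μ₀ ∘ mk = (A ⊆ F)_* ∘ θ_A`; and
  `GayKirby.sphereSector_exists_jointChart_datum` — **unconditionally**: at every point of the
  central `2`-sphere, a joint chart, the cell `Φ(z) = Θ⁻¹(0, 0, ρ z)` and the whole datum based at
  `Φ(1, 0)` (uses `sphereSector_isBalancedGKTrisection_holds`).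

## References

* D. Gay, R. Kirby, *Trisecting 4-manifolds*, Geom. Topol. 20 (2016) 3097–3132
  (arXiv:1205.1565): §2 (arXiv p. 5), first example, and Def. 8, Lemma 10 (p. 3100).
  [GayKirby2016]
* A. Abrams, D. Gay, R. Kirby, *Group trisections and smooth 4-manifolds*, Geom. Topol. 22
  (2018) 1537–1545: Thm. 5 (p. 1541: "The unique `(0, 0)`-trisection of `{1}` maps to the unique
  `(0, 0)`-trisection of `S⁴`"). [AbramsGayKirby2018]
* A. Hatcher, *Algebraic Topology*, CUP (2002): Ch. 0 p. 2 (deformation retractions), Thm. 1.7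
  (`π₁(S¹)`), Prop. 1.14 (`π₁(Sⁿ) = 0`), Prop. 1.26 and its proof. [HatcherAT2002]
-/

noncomputable section

open Set Metric Function
open Literature.AlgebraicTopology.FundamentalGroup
open Literature.AlgebraicTopology.FundamentalGroup.VanKampen
open Literature.AlgebraicTopology.Homotopy
open scoped unitInterval Topology Manifold ContDiff

namespace Literature.Topology.FourManifolds

universe u

/-! ### Set algebra of a chart-like `2`-cell in a closed set -/

section Cell

variable {X : Type u} [TopologicalSpace X] {F O : Set X}
  (Φ : C(closedBall (0 : EuclideanSpace ℝ (Fin 2)) 2, X))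

/-- For a chart-like `2`-cell `Φ : B̄(0,2) → F` (`F ∩ O = Φ(B(0,2))`, `Φ` injective),
`F ∖ Φ(B(0,1)) = (F ∖ O) ∪ (F ∩ Φ(1 ≤ ‖z‖))`. [folklore] -/
theorem diff_image_ball_eq_union (hinj : Injective Φ)
    (hFO : F ∩ O = Φ '' {z | ‖(z : EuclideanSpace ℝ (Fin 2))‖ < 2}) :
    F \ Φ '' {z | ‖(z : EuclideanSpace ℝ (Fin 2))‖ < 1} =
      (F \ O) ∪ (F ∩ Φ '' {z | 1 ≤ ‖(z : EuclideanSpace ℝ (Fin 2))‖}) := by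
  ext x
  simp only [mem_sdiff, mem_union, mem_inter_iff, mem_image, mem_setOf_eq, not_exists, not_and]
  constructor
  · rintro ⟨hxF, hx⟩
    by_cases hxO : x ∈ O
    · have hx2 : x ∈ F ∩ O := ⟨hxF, hxO⟩
      rw [hFO] at hx2
      obtain ⟨z, hz2, rfl⟩ := hx2
      refine Or.inr ⟨hxF, z, ?_, rfl⟩
      by_contra h
      exact hx z (lt_of_not_ge h) rfl
    · exact Or.inl ⟨hxF, hxO⟩
  · rintro (⟨hxF, hxO⟩ | ⟨hxF, z, hz1, rfl⟩)
    · refine ⟨hxF, fun z hz1 hzx => hxO ?_⟩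
      have : Φ z ∈ F ∩ O := by
        rw [hFO]
        exact ⟨z, by simp only [mem_setOf_eq]; linarith, rfl⟩
      rw [hzx] at this
      exact this.2
    · refine ⟨hxF, fun w hw1 hwz => ?_⟩
      have := hinj hwz
      subst this
      exact absurd hz1 (not_le.mpr hw1)

/-- `A = F ∖ Φ(B(0,1))` is closed (`F` closed, `O` open, `Φ(1 ≤ ‖z‖)` compact). [folklore] -/
theorem isClosed_diff_image_ball [T2Space X] (hF : IsClosed F) (hinj : Injective Φ)
    (hO : IsOpen O) (hFO : F ∩ O = Φ '' {z | ‖(z : EuclideanSpace ℝ (Fin 2))‖ < 2}) :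
    IsClosed (F \ Φ '' {z | ‖(z : EuclideanSpace ℝ (Fin 2))‖ < 1}) := by
  haveI : CompactSpace (closedBall (0 : EuclideanSpace ℝ (Fin 2)) 2) :=
    isCompact_iff_compactSpace.mp (isCompact_closedBall 0 2)
  rw [diff_image_ball_eq_union Φ hinj hFO]
  refine (hF.sdiff hO).union (hF.inter (IsCompact.isClosed ?_))
  refine (IsClosed.isCompact ?_).image Φ.continuous
  exact isClosed_le continuous_const (continuous_norm.comp continuous_subtype_val)

/-- The trace of the open set on `A` is the collar: `(F ∖ Φ(B(0,1))) ∩ O = Φ(1 ≤ ‖z‖ < 2)`. [folklore] -/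
theorem diff_image_ball_inter_eq (hinj : Injective Φ)
    (hFO : F ∩ O = Φ '' {z | ‖(z : EuclideanSpace ℝ (Fin 2))‖ < 2}) :
    (F \ Φ '' {z | ‖(z : EuclideanSpace ℝ (Fin 2))‖ < 1}) ∩ O =
      Φ '' {z | 1 ≤ ‖(z : EuclideanSpace ℝ (Fin 2))‖ ∧ ‖(z : EuclideanSpace ℝ (Fin 2))‖ < 2} := by
  ext x
  simp only [mem_inter_iff, mem_sdiff, mem_image, mem_setOf_eq, not_exists, not_and]
  constructor
  · rintro ⟨⟨hxF, hx⟩, hxO⟩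
    have hx2 : x ∈ F ∩ O := ⟨hxF, hxO⟩
    rw [hFO] at hx2
    obtain ⟨z, hz2, rfl⟩ := hx2
    exact ⟨z, ⟨le_of_not_gt fun h => hx z h rfl, hz2⟩, rfl⟩
  · rintro ⟨z, ⟨hz1, hz2⟩, rfl⟩
    have hz : Φ z ∈ F ∩ O := by
      rw [hFO]
      exact ⟨z, hz2, rfl⟩
    refine ⟨⟨hz.1, fun w hw1 hwz => ?_⟩, hz.2⟩
    have := hinj hwz
    subst this
    exact absurd hz1 (not_le.mpr hw1)

/-- The seam circle lies in `A`: `Φ(‖z‖ = 1) ⊆ F ∖ Φ(B(0,1))`. [folklore] -/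
theorem image_sphere_subset_diff_image_ball (hinj : Injective Φ) (hΦF : range Φ ⊆ F) :
    Φ '' {z | ‖(z : EuclideanSpace ℝ (Fin 2))‖ = 1} ⊆
      F \ Φ '' {z | ‖(z : EuclideanSpace ℝ (Fin 2))‖ < 1} := by
  rintro x ⟨z, hz1, rfl⟩
  refine ⟨hΦF (mem_range_self z), ?_⟩
  rintro ⟨w, hw1, hwz⟩
  have := hinj hwz
  subst this
  simp only [mem_setOf_eq] at hz1 hw1
  linarith

/-- The seam circle lies in the collar: `Φ(‖z‖ = 1) ⊆ Φ(1 ≤ ‖z‖ < 2)`. [folklore] -/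
theorem image_sphere_subset_image_collar :
    Φ '' {z | ‖(z : EuclideanSpace ℝ (Fin 2))‖ = 1} ⊆
      Φ '' {z | 1 ≤ ‖(z : EuclideanSpace ℝ (Fin 2))‖ ∧ ‖(z : EuclideanSpace ℝ (Fin 2))‖ < 2} :=
  image_mono fun z hz => by
    simp only [mem_setOf_eq] at hz ⊢
    constructor <;> linarith

end Cell

/-! ### The unit sub-cell `Φ|B̄(0,1)` -/

section SubCell

variable {X : Type u} [TopologicalSpace X] {F : Set X}
  (Φ : C(closedBall (0 : EuclideanSpace ℝ (Fin 2)) 2, X))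

/-- `B̄(0,1) ⊆ B̄(0,2)` in `ℝ²`. [folklore] -/
private theorem closedBall_one_subset_two :
    closedBall (0 : EuclideanSpace ℝ (Fin 2)) 1 ⊆ closedBall 0 2 :=
  closedBall_subset_closedBall one_le_two

/-- The unit sub-cell of an injective cell is injective. [folklore] -/
private theorem injective_comp_inclusion (hinj : Injective Φ) :
    Injective (Φ.comp (ContinuousMap.inclusion closedBall_one_subset_two)) := fun x y h => by
  have h' : ContinuousMap.inclusion closedBall_one_subset_two x =
      ContinuousMap.inclusion closedBall_one_subset_two y := hinj h
  have h'' := congrArg (Subtype.val : closedBall (0 : EuclideanSpace ℝ (Fin 2)) 2 → _) h'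
  exact Subtype.ext h''

/-- The unit sub-cell meets `A = F ∖ Φ(B(0,1))` exactly along its boundary circle (the shape
`Φ x ∈ A ↔ ‖x‖ = 1` of the cell-attachment lemmas). [folklore] -/
private theorem comp_inclusion_mem_iff (hinj : Injective Φ) (hΦF : range Φ ⊆ F)
    (x : closedBall (0 : EuclideanSpace ℝ (Fin 2)) 1) :
    Φ.comp (ContinuousMap.inclusion closedBall_one_subset_two) x ∈
        F \ Φ '' {z | ‖(z : EuclideanSpace ℝ (Fin 2))‖ < 1} ↔
      ‖(x : EuclideanSpace ℝ (Fin 2))‖ = 1 := by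
  have hCA := image_sphere_subset_diff_image_ball Φ hinj hΦF
  constructor
  · intro hx
    have hx1 : ‖(x : EuclideanSpace ℝ (Fin 2))‖ ≤ 1 := mem_closedBall_zero_iff.mp x.2
    refine le_antisymm hx1 (le_of_not_gt fun hlt => hx.2
      ⟨ContinuousMap.inclusion closedBall_one_subset_two x, ?_, rfl⟩)
    exact hlt
  · intro hx
    exact hCA ⟨ContinuousMap.inclusion closedBall_one_subset_two x, hx, rfl⟩

/-- `A ∪ Φ(B̄(0,1)) = F`. [folklore] -/
private theorem union_range_comp_inclusion_eq (hΦF : range Φ ⊆ F) :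
    (F \ Φ '' {z | ‖(z : EuclideanSpace ℝ (Fin 2))‖ < 1}) ∪
        range (Φ.comp (ContinuousMap.inclusion closedBall_one_subset_two)) = F := by
  apply subset_antisymm
  · rintro x (hx | ⟨y, rfl⟩)
    · exact hx.1
    · exact hΦF ⟨_, rfl⟩
  · intro x hxF
    by_cases hx : x ∈ Φ '' {z | ‖(z : EuclideanSpace ℝ (Fin 2))‖ < 1}
    · obtain ⟨z, hz1, rfl⟩ := hx
      exact Or.inr ⟨⟨(z : EuclideanSpace ℝ (Fin 2)), mem_closedBall_zero_iff.mpr (le_of_lt hz1)⟩, rfl⟩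
    · exact Or.inl ⟨hxF, hx⟩

end SubCell

/-! ### The collar retraction -/

section Collar

variable {E : Type*} [NormedAddCommGroup E] [NormedSpace ℝ E]

/-- **The inner sphere is a strong deformation retract of a half-open annulus**: for `0 < a < b`
the radial deformation `(t, z) ↦ ((1 - t) + t a/‖z‖) z` retracts `{a ≤ ‖z‖ < b}` onto `{‖z‖ = a}`
inside itself, fixing the sphere (Hatcher, Ch. 0 p. 2). [cite: HatcherAT2002, Ch. 0, p. 2] -/
theorem isStrongDeformationRetractOf_sphere_halfOpenAnnulus {a b : ℝ} (ha : 0 < a) (hab : a < b) :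
    IsStrongDeformationRetractOf (sphere (0 : E) a) {z : E | a ≤ ‖z‖ ∧ ‖z‖ < b} := by
  -- the radial deformation and its norm
  set H : ℝ → E → E := fun t z => ((1 - t) + t * (a / ‖z‖)) • z with hH
  have hnorm : ∀ {t : ℝ} {z : E}, t ∈ Icc (0 : ℝ) 1 → a ≤ ‖z‖ →
      ‖H t z‖ = (1 - t) * ‖z‖ + t * a := by
    intro t z ht hz
    have hz0 : 0 < ‖z‖ := ha.trans_le hz
    have hcoef : 0 ≤ (1 - t) + t * (a / ‖z‖) :=
      add_nonneg (by linarith [ht.2]) (mul_nonneg ht.1 (div_nonneg ha.le hz0.le))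
    simp only [hH, norm_smul, Real.norm_of_nonneg hcoef]
    rw [add_mul, mul_assoc, div_mul_cancel₀ a hz0.ne']
  refine IsStrongDeformationRetractOf.of_continuousOn H ?_ ?_ ?_ ?_ ?_
  · -- continuity on `[0, 1] × S` (the norm does not vanish there)
    refine ContinuousOn.smul ?_ continuousOn_snd
    refine (continuousOn_const.sub continuousOn_fst).add (continuousOn_fst.mul
      (continuousOn_const.div (continuous_norm.comp_continuousOn continuousOn_snd) fun p hp => ?_))
    exact (ha.trans_le hp.2.1).ne'
  · -- the annulus is preserved
    intro t ht z hz
    have hn := hnorm ht hz.1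
    refine ⟨?_, ?_⟩
    · rw [hn]
      nlinarith [hz.1, ht.1, ht.2]
    · rw [hn]
      rcases ht.1.eq_or_lt with h | h
      · rw [← h]; simpa using hz.2
      · nlinarith [hz.2, ht.2]
  · intro z _
    simp [hH]
  · intro z hz
    have hn := hnorm ⟨zero_le_one, le_rfl⟩ hz.1
    rw [mem_sphere_zero_iff_norm, hn]
    ring
  · intro t _ z _ hza
    rw [mem_sphere_zero_iff_norm] at hza
    have hc : (1 - t) + t * (a / ‖z‖) = 1 := by
      rw [hza, div_self ha.ne']
      ring
    simp only [hH, hc, one_smul]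

variable {X : Type u} [TopologicalSpace X] [T2Space X]

/-- **The collar of the seam circle.**  For a continuous injective `Φ : B̄(0,2) ⊂ ℝ² → X` into a
Hausdorff space, `Φ(1 ≤ ‖z‖ < 2)` strong deformation retracts onto `Φ(‖z‖ = 1)`: the radial
deformation transported along the embedding `Φ` (hypothesis `hsdrCA` of the stabilisation step).
[cite: HatcherAT2002, Ch. 0, p. 2] -/
theorem isStrongDeformationRetractOf_image_sphere_collar
    (Φ : C(closedBall (0 : EuclideanSpace ℝ (Fin 2)) 2, X)) (hinj : Injective Φ) :
    IsStrongDeformationRetractOf (Φ '' {z | ‖(z : EuclideanSpace ℝ (Fin 2))‖ = 1})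
      (Φ '' {z | 1 ≤ ‖(z : EuclideanSpace ℝ (Fin 2))‖ ∧ ‖(z : EuclideanSpace ℝ (Fin 2))‖ < 2}) := by
  have h := (isStrongDeformationRetractOf_sphere_halfOpenAnnulus (E := EuclideanSpace ℝ (Fin 2))
    one_pos one_lt_two).preimage_val (W := closedBall (0 : EuclideanSpace ℝ (Fin 2)) 2)
    (fun z hz => mem_closedBall_zero_iff.mpr hz.2.le)
  haveI : CompactSpace (closedBall (0 : EuclideanSpace ℝ (Fin 2)) 2) :=
    isCompact_iff_compactSpace.mp (isCompact_closedBall 0 2)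
  have hemb : Topology.IsEmbedding Φ := (Φ.continuous.isClosedEmbedding hinj).isEmbedding
  have h' := h.image_of_isEmbedding hemb
  convert h' using 2
  · ext z
    simp
  · ext z
    simp

end Collar

/-! ### Simple connectivity of the complement, the seam circle and its fundamental group -/

section Complement

variable {X : Type u} [TopologicalSpace X] {F O : Set X}
  (Φ : C(closedBall (0 : EuclideanSpace ℝ (Fin 2)) 2, X))

/-- **`A = F ∖ Φ(B(0,1))` is simply connected when `F ∖ {Φ 0}` is** (Hatcher, proof of
Prop. 1.26: `A` is a strong deformation retract of `F ∖ {Φ 0} = (A ∪ Φ(B̄(0,1))) ∖ {Φ 0}` along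
the radii of the cell; `isSimplyConnected_union_range_diff_singleton_iff` applied to the unit
sub-cell `Φ|B̄(0,1)`). [cite: HatcherAT2002, proof of Prop. 1.26] -/
theorem isSimplyConnected_diff_image_ball [T2Space X] (hF : IsClosed F) (hinj : Injective Φ)
    (hΦF : range Φ ⊆ F) (hO : IsOpen O)
    (hFO : F ∩ O = Φ '' {z | ‖(z : EuclideanSpace ℝ (Fin 2))‖ < 2})
    (hF0 : IsSimplyConnected (F \ {Φ ⟨0, by simp⟩})) :
    IsSimplyConnected (F \ Φ '' {z | ‖(z : EuclideanSpace ℝ (Fin 2))‖ < 1}) := by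
  have key := (isSimplyConnected_union_range_diff_singleton_iff
    (Φ.comp (ContinuousMap.inclusion closedBall_one_subset_two))
    (isClosed_diff_image_ball Φ hF hinj hO hFO) (comp_inclusion_mem_iff Φ hinj hΦF)
    (injective_comp_inclusion Φ hinj)).1
  rw [union_range_comp_inclusion_eq Φ hΦF] at key
  exact key hF0

/-- **The seam circle `C = Φ(‖z‖ = 1)` is path connected** (a continuous image of the unit
circle of `ℝ²`). [folklore] -/
theorem isPathConnected_image_sphere :
    IsPathConnected (Φ '' {z | ‖(z : EuclideanSpace ℝ (Fin 2))‖ = 1}) := by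
  have hrank : 1 < Module.rank ℝ (EuclideanSpace ℝ (Fin 2)) := by
    rw [← Module.finrank_eq_rank, finrank_euclideanSpace_fin]
    norm_num
  have h := (isPathConnected_sphere hrank (0 : EuclideanSpace ℝ (Fin 2)) zero_le_one).preimage_coe
    (U := closedBall (0 : EuclideanSpace ℝ (Fin 2)) 2)
    (sphere_subset_closedBall.trans (closedBall_subset_closedBall one_le_two))
  convert h.image Φ.continuous using 2
  ext z
  simp

/-- **`π₁` of the seam circle is cyclic at every base point**: for `Φ : B̄(0,2) ⊂ ℝ² → X`
continuous and injective into a Hausdorff space and any `x₀ ∈ C = Φ(‖z‖ = 1)`, some class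
generates `π₁(C, x₀)` — the loop `t ↦ Φ(cos 2πt, sin 2πt)` is a simple closed curve tracing out
`C` (Hatcher Thm. 1.7, via `zpowers_liftPath_eq_top_of_simpleClosed`), and the generator is moved
to `x₀` along a path in `C` (hypothesis `ht` of the stabilisation step).
[cite: HatcherAT2002, Thm. 1.7 (p. 29) and Prop. 1.5] -/
theorem exists_closure_singleton_eq_top_image_sphere [T2Space X] (hinj : Injective Φ) {x₀ : X}
    (hx₀ : x₀ ∈ Φ '' {z | ‖(z : EuclideanSpace ℝ (Fin 2))‖ = 1}) :
    ∃ t : FundamentalGroup ↥(Φ '' {z | ‖(z : EuclideanSpace ℝ (Fin 2))‖ = 1}) ⟨x₀, hx₀⟩,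
      Subgroup.closure {t} = ⊤ := by
  set C := Φ '' {z | ‖(z : EuclideanSpace ℝ (Fin 2))‖ = 1} with hCdef
  set ι : C(closedBall (0 : EuclideanSpace ℝ (Fin 2)) 1, closedBall (0 : EuclideanSpace ℝ (Fin 2)) 2) :=
    ContinuousMap.inclusion closedBall_one_subset_two with hι
  have hιv : ∀ x, ((ι x : closedBall (0 : EuclideanSpace ℝ (Fin 2)) 2) :
      EuclideanSpace ℝ (Fin 2)) = x := fun x => rfl
  -- the standard loop around `C`
  set γ := (euclideanCircleLoop.map ι.continuous).map Φ.continuous with hγ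
  have hγt : ∀ t, γ t = Φ (ι (euclideanCircleLoop t)) := fun t => rfl
  have hγC : ∀ t, γ t ∈ C := fun t =>
    ⟨ι (euclideanCircleLoop t), by simpa [hιv] using norm_euclideanCircleLoop t, rfl⟩
  have hCγ : C ⊆ range γ := by
    rintro x ⟨z, hz1, rfl⟩
    have hz1' : ‖(z : EuclideanSpace ℝ (Fin 2))‖ = 1 := hz1
    set z' : closedBall (0 : EuclideanSpace ℝ (Fin 2)) 1 :=
      ⟨z, mem_closedBall_zero_iff.mpr hz1'.le⟩ with hz'
    obtain ⟨t, ht⟩ := mem_range_euclideanCircleLoop z' hz1'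
    refine ⟨t, ?_⟩
    rw [hγt, ht]
    exact congrArg Φ (Subtype.ext rfl)
  have hγinj : ∀ s t : I, γ s = γ t → s = t ∨ (s = 0 ∧ t = 1) ∨ (s = 1 ∧ t = 0) := by
    intro s t h
    rw [hγt, hγt] at h
    have h' : ι (euclideanCircleLoop s) = ι (euclideanCircleLoop t) := hinj h
    have h'' := congrArg (Subtype.val : closedBall (0 : EuclideanSpace ℝ (Fin 2)) 2 → _) h'
    exact euclideanCircleLoop_eq_iff s t (Subtype.ext h'')
  have hb : γ 0 ∈ C := hγC 0
  -- the generator at the base point of the loop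
  have hgen := zpowers_liftPath_eq_top_of_simpleClosed γ hγinj hγC hCγ (by simpa using hb)
  set b : X := Φ (ι ⟨Complex.orthonormalBasisOneI.repr 1, by simp⟩) with hbdef
  have hbC : b ∈ C := by simpa using hb
  obtain ⟨t₀, ht₀⟩ : ∃ t₀ : FundamentalGroup ↥C ⟨b, hbC⟩, Subgroup.closure {t₀} = ⊤ :=
    ⟨_, by rw [← Subgroup.zpowers_eq_closure]; exact hgen⟩
  -- move it to `x₀` along a path in `C`
  haveI : PathConnectedSpace ↥C :=
    isPathConnected_iff_pathConnectedSpace.mp (isPathConnected_image_sphere Φ)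
  let p : Path (⟨b, hbC⟩ : ↥C) ⟨x₀, hx₀⟩ := PathConnectedSpace.somePath _ _
  let e := FundamentalGroup.fundamentalGroupMulEquivOfPath p
  refine ⟨e t₀, ?_⟩
  have : Subgroup.closure {e t₀} = (Subgroup.closure {t₀}).map e.toMonoidHom := by
    rw [MonoidHom.map_closure, image_singleton, MulEquiv.coe_toMonoidHom]
  rw [this, ht₀, ← MonoidHom.range_eq_map, MonoidHom.range_eq_top]
  exact e.surjective

end Complement

/-! ### The old-handlebody input `hsAH` of the stabilisation step -/

section OldSide

variable {X : Type u} [TopologicalSpace X] {F O : Set X}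
  (Φ : C(closedBall (0 : EuclideanSpace ℝ (Fin 2)) 2, X))

/-- **`π₁(A, x₀) → π₁(F, x₀)` is onto** for `A = F ∖ Φ(B(0,1))`, `Φ` a chart-like `2`-cell in the
closed `F` and `A` path connected: `F = A ∪ Φ(B̄(0,1))` is `A` with one `2`-cell attached
(Hatcher, Prop. 1.26 (a): attaching `2`-cells induces a surjection on `π₁`;
`VanKampen.surjective_inclHomOfSubset_union_range`). [cite: HatcherAT2002, Prop. 1.26 (a) (p. 50)] -/
theorem surjective_inclHomOfSubset_diff_image_ball [T2Space X] (hF : IsClosed F)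
    (hinj : Injective Φ) (hΦF : range Φ ⊆ F) (hO : IsOpen O)
    (hFO : F ∩ O = Φ '' {z | ‖(z : EuclideanSpace ℝ (Fin 2))‖ < 2})
    (hApc : IsPathConnected (F \ Φ '' {z | ‖(z : EuclideanSpace ℝ (Fin 2))‖ < 1}))
    {x₀ : X} (hx₀ : x₀ ∈ F \ Φ '' {z | ‖(z : EuclideanSpace ℝ (Fin 2))‖ < 1}) :
    Surjective (inclHomOfSubset
      (fun _ hx => hx.1 : F \ Φ '' {z | ‖(z : EuclideanSpace ℝ (Fin 2))‖ < 1} ⊆ F) x₀ hx₀ hx₀.1) := by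
  have key := surjective_inclHomOfSubset_union_range
    (Φ.comp (ContinuousMap.inclusion closedBall_one_subset_two))
    (isClosed_diff_image_ball Φ hF hinj hO hFO) hApc (comp_inclusion_mem_iff Φ hinj hΦF)
    (injective_comp_inclusion Φ hinj) (by rw [finrank_euclideanSpace_fin]) hx₀
  exact (surjective_inclHomOfSubset_congr (union_range_comp_inclusion_eq Φ hΦF) _ _ hx₀).1 key

omit [TopologicalSpace X] in
/-- **Surjectivity onto an intermediate piece which injects.**  If `A ⊆ A^H ⊆ H` and
`A ⊆ F ⊆ H`, `π₁(A) → π₁(F)` and `π₁(F) → π₁(H)` are onto and `π₁(A^H) → π₁(H)` is into (all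
induced by inclusions, at `x₀ ∈ A`), then `π₁(A) → π₁(A^H)` is onto: for `y ∈ π₁(A^H)` pick
`a ∈ π₁(A)` with the same image in `π₁(H)`; injectivity gives `a ↦ y`.  (The shape of
hypothesis `hsAH` of the stabilisation step: `A = F ∖ D̊`, `F` the central surface, `H` a
handlebody, `A^H = H` minus a half-ball bite.) [folklore] -/
theorem surjective_inclHomOfSubset_of_surjective_of_injective [TopologicalSpace X]
    {A AH H F' : Set X} (hAAH : A ⊆ AH) (hAHH : AH ⊆ H) (hAF : A ⊆ F') (hFH : F' ⊆ H)
    {x₀ : X} (hx₀ : x₀ ∈ A)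
    (hsF : Surjective (inclHomOfSubset hAF x₀ hx₀ (hAF hx₀)))
    (hsH : Surjective (inclHomOfSubset hFH x₀ (hAF hx₀) (hFH (hAF hx₀))))
    (hj : Injective (inclHomOfSubset hAHH x₀ (hAAH hx₀) (hAHH (hAAH hx₀)))) :
    Surjective (inclHomOfSubset hAAH x₀ hx₀ (hAAH hx₀)) := by
  intro y
  obtain ⟨f, hf⟩ := hsH (inclHomOfSubset hAHH x₀ (hAAH hx₀) (hAHH (hAAH hx₀)) y)
  obtain ⟨a, rfl⟩ := hsF f
  refine ⟨a, hj ?_⟩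
  rw [inclHomOfSubset_inclHomOfSubset, ← hf, inclHomOfSubset_inclHomOfSubset]

variable [T2Space X] [SecondCountableTopology X] [ChartedSpace (EuclideanSpace ℝ (Fin 4)) X]
  {g : ℕ} {k : Fin 3 → ℕ} {S : Fin 3 → Set X}

/-- **Hypothesis `hsAH` of the stabilisation step from clause (iii) and the bite.**  For a
Gay–Kirby trisection `S` with central surface `F = ⋂ₗ Sₗ`, a chart-like `2`-cell `Φ` in `F`
with `A = F ∖ Φ(B(0,1))` path connected, `x₀ ∈ A`, and any `A^H` with `A ⊆ A^H ⊆ Hᵢ = S(i+1) ∩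
S(i+2)` such that `π₁(A^H, x₀) → π₁(Hᵢ, x₀)` is injective (the handlebody minus a half-ball
bite), the map `π₁(A, x₀) → π₁(A^H, x₀)` is surjective: `π₁(A) ↠ π₁(F)` (one `2`-cell, Hatcher
1.26 (a)) and `π₁(F) ↠ π₁(Hᵢ)` (`IsGKTrisection.surjective_inclHomOfSubset_handlebody`, Morse
theory of the `1`-handlebody). [cite: AbramsGayKirby2018, p. 1540 (𝒢 : S_g ↠ H_g)]
[cite: HatcherAT2002, Prop. 1.26 (a) (p. 50)] -/
theorem IsGKTrisection.surjective_inclHomOfSubset_diff_image_ball_bite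
    (h : IsGKTrisection X g k S)
    (Φ : C(closedBall (0 : EuclideanSpace ℝ (Fin 2)) 2, X)) (hinj : Injective Φ)
    (hΦF : range Φ ⊆ ⋂ l, S l) (hO : IsOpen O)
    (hFO : (⋂ l, S l) ∩ O = Φ '' {z | ‖(z : EuclideanSpace ℝ (Fin 2))‖ < 2})
    (hApc : IsPathConnected ((⋂ l, S l) \ Φ '' {z | ‖(z : EuclideanSpace ℝ (Fin 2))‖ < 1}))
    {x₀ : X} (hx₀ : x₀ ∈ (⋂ l, S l) \ Φ '' {z | ‖(z : EuclideanSpace ℝ (Fin 2))‖ < 1})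
    (i : Fin 3) {AH : Set X}
    (hAAH : (⋂ l, S l) \ Φ '' {z | ‖(z : EuclideanSpace ℝ (Fin 2))‖ < 1} ⊆ AH)
    (hAHH : AH ⊆ S (i + 1) ∩ S (i + 2))
    (hjA : Injective (inclHomOfSubset hAHH x₀ (hAAH hx₀) (hAHH (hAAH hx₀)))) :
    Surjective (inclHomOfSubset hAAH x₀ hx₀ (hAAH hx₀)) := by
  have hF : IsClosed (⋂ l, S l) := h.isCompact_iInter.isClosed
  exact surjective_inclHomOfSubset_of_surjective_of_injective hAAH hAHH (fun _ hx => hx.1)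
    (iInter_subset_inter S i) hx₀
    (surjective_inclHomOfSubset_diff_image_ball Φ hF hinj hΦF hO hFO hApc hx₀)
    (h.surjective_inclHomOfSubset_handlebody i hx₀.1) hjA

end OldSide

/-! ### The genus-`0` datum of a chart-like `2`-cell -/

section Datum

variable {X : Type u} [TopologicalSpace X] [T2Space X] {F O : Set X}

/-- **The genus-`0` free-basis datum of a chart-like `2`-cell.**  Let `F ⊆ X` be closed in the
Hausdorff space `X`, `Φ : B̄(0, 2) ⊂ ℝ² → X` continuous and injective with `Φ(B̄(0,2)) ⊆ F` and
`F ∩ O = Φ(B(0, 2))` for an open `O` (a chart-like `2`-cell: e.g. a coordinate disc of a chart of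
a surface `F`), and suppose `F ∖ {Φ 0}` is simply connected (e.g. `F` a `2`-sphere).  Put
`D = Φ(B̄(0,1))`, `A = F ∖ D̊ = F ∖ Φ(B(0,1))`, `C = ∂D = Φ(‖z‖ = 1)`, `C_A = Φ(1 ≤ ‖z‖ < 2)`.
Then for every `x₀ ∈ C`: `A` is closed, `C ⊆ A`, `C_A = A ∩ O ⊇ C` strong deformation retracts
onto `C`, `A` is simply connected (so path connected, with `π₁(A, x₀) = 1 ≅ F⟨∅⟩ = F⟨a₁,…,b₀⟩`),
`C` is path connected, `π₁(C, x₀)` is generated by one class `t`, `F` is simply connected, and —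
trivially, all groups in sight at genus `0` being trivial or the statements being about maps out
of the trivial free group — `θ_A(r_0) = t` read in `A` and `μ₀ ∘ mk = (A ⊆ F)_* ∘ θ_A` for EVERY
`μ₀ : S_0 ≃* π₁(F, x₀)`.  These are the hypotheses `hA … hμ₀` (old-surface part) of
`exists_marking_groupGKTrisectionOf_eq_stabilize_datum` at `g = 0`.
[cite: GayKirby2016, §2 (arXiv p. 5), first example] [cite: HatcherAT2002, Prop. 1.26 (proof), Thm. 1.7] -/
theorem exists_datum_genus_zero_of_cell (hF : IsClosed F)
    (Φ : C(closedBall (0 : EuclideanSpace ℝ (Fin 2)) 2, X)) (hinj : Injective Φ)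
    (hΦF : range Φ ⊆ F) (hO : IsOpen O)
    (hFO : F ∩ O = Φ '' {z | ‖(z : EuclideanSpace ℝ (Fin 2))‖ < 2})
    (hF0 : IsSimplyConnected (F \ {Φ ⟨0, by simp⟩})) {x₀ : X}
    (hx₀ : x₀ ∈ Φ '' {z | ‖(z : EuclideanSpace ℝ (Fin 2))‖ = 1}) :
    ∃ (_hA : IsClosed (F \ Φ '' {z | ‖(z : EuclideanSpace ℝ (Fin 2))‖ < 1}))
      (hCA : Φ '' {z | ‖(z : EuclideanSpace ℝ (Fin 2))‖ = 1} ⊆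
        F \ Φ '' {z | ‖(z : EuclideanSpace ℝ (Fin 2))‖ < 1})
      (_hCAe : Φ '' {z | 1 ≤ ‖(z : EuclideanSpace ℝ (Fin 2))‖ ∧ ‖(z : EuclideanSpace ℝ (Fin 2))‖ < 2} =
        (F \ Φ '' {z | ‖(z : EuclideanSpace ℝ (Fin 2))‖ < 1}) ∩ O)
      (_hCCA : Φ '' {z | ‖(z : EuclideanSpace ℝ (Fin 2))‖ = 1} ⊆
        Φ '' {z | 1 ≤ ‖(z : EuclideanSpace ℝ (Fin 2))‖ ∧ ‖(z : EuclideanSpace ℝ (Fin 2))‖ < 2})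
      (_hsdrCA : IsStrongDeformationRetractOf (Φ '' {z | ‖(z : EuclideanSpace ℝ (Fin 2))‖ = 1})
        (Φ '' {z | 1 ≤ ‖(z : EuclideanSpace ℝ (Fin 2))‖ ∧ ‖(z : EuclideanSpace ℝ (Fin 2))‖ < 2}))
      (_hAsc : IsSimplyConnected (F \ Φ '' {z | ‖(z : EuclideanSpace ℝ (Fin 2))‖ < 1}))
      (_hApc : IsPathConnected (F \ Φ '' {z | ‖(z : EuclideanSpace ℝ (Fin 2))‖ < 1}))
      (_hCpc : IsPathConnected (Φ '' {z | ‖(z : EuclideanSpace ℝ (Fin 2))‖ = 1}))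
      (hAF : F \ Φ '' {z | ‖(z : EuclideanSpace ℝ (Fin 2))‖ < 1} ⊆ F)
      (_hFsc : IsSimplyConnected F)
      (t : FundamentalGroup ↥(Φ '' {z | ‖(z : EuclideanSpace ℝ (Fin 2))‖ = 1}) ⟨x₀, hx₀⟩)
      (θA : FreeGroup (surfaceGen 0) ≃*
        FundamentalGroup ↥(F \ Φ '' {z | ‖(z : EuclideanSpace ℝ (Fin 2))‖ < 1}) ⟨x₀, hCA hx₀⟩),
      Subgroup.closure {t} = ⊤ ∧
      θA (surfaceRelator 0) = inclHomOfSubset hCA x₀ hx₀ (hCA hx₀) t ∧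
      ∀ μ₀ : SurfaceGroup 0 ≃* FundamentalGroup ↥F ⟨x₀, hAF (hCA hx₀)⟩,
        μ₀.toMonoidHom.comp (PresentedGroup.mk _) =
          (inclHomOfSubset hAF x₀ (hCA hx₀) (hAF (hCA hx₀))).comp θA.toMonoidHom := by
  have hA := isClosed_diff_image_ball Φ hF hinj hO hFO
  have hCA := image_sphere_subset_diff_image_ball Φ hinj hΦF
  have hCAe := (diff_image_ball_inter_eq Φ hinj hFO).symm
  have hCCA := image_sphere_subset_image_collar Φ
  have hsdr := isStrongDeformationRetractOf_image_sphere_collar Φ hinj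
  have hAsc := isSimplyConnected_diff_image_ball Φ hF hinj hΦF hO hFO hF0
  have hCpc := isPathConnected_image_sphere Φ
  have hAF : F \ Φ '' {z | ‖(z : EuclideanSpace ℝ (Fin 2))‖ < 1} ⊆ F := fun _ hx => hx.1
  obtain ⟨t, ht⟩ := exists_closure_singleton_eq_top_image_sphere Φ hinj hx₀
  -- `F = A ∪ Φ(B̄(0,1))` is simply connected (Hatcher 1.26 (a), trivial-`π₁` form)
  have hFsc : IsSimplyConnected F := by
    have := isSimplyConnected_union_range_of_isSimplyConnected
      (Φ.comp (ContinuousMap.inclusion closedBall_one_subset_two)) hA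
      (comp_inclusion_mem_iff Φ hinj hΦF) (injective_comp_inclusion Φ hinj)
      (by rw [finrank_euclideanSpace_fin]) hAsc
    rwa [union_range_comp_inclusion_eq Φ hΦF] at this
  -- the trivial free basis of `π₁(A, x₀) = 1`
  haveI : SimplyConnectedSpace ↥(F \ Φ '' {z | ‖(z : EuclideanSpace ℝ (Fin 2))‖ < 1}) := hAsc
  haveI : SimplyConnectedSpace ↥F := hFsc
  haveI : IsEmpty (surfaceGen 0) := inferInstance
  letI : Unique (FreeGroup (surfaceGen 0)) := inferInstance
  letI : Unique (FundamentalGroup ↥(F \ Φ '' {z | ‖(z : EuclideanSpace ℝ (Fin 2))‖ < 1})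
    ⟨x₀, hCA hx₀⟩) := uniqueOfSubsingleton 1
  refine ⟨hA, hCA, hCAe, hCCA, hsdr, hAsc, hAsc.isPathConnected, hCpc, hAF, hFsc, t,
    MulEquiv.ofUnique, ht, Subsingleton.elim _ _, fun μ₀ => ?_⟩
  exact MonoidHom.ext fun _ => Subsingleton.elim _ _

end Datum


/-! ### Chart-like `2`-cells from charts straightening the central surface -/

section ChartCell

variable {X : Type u} [TopologicalSpace X] {F : Set X}

/-- **A chart straightening `F` yields chart-like `2`-cells in `F` centred at the point.**  Let
`Θ` be a local homeomorphism of `X` onto an open subset of `ℝ⁴` with `Θ x = 0` and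
`F ∩ Θ.source = {q₀ = q₁ = 0}` (e.g. the joint chart of a Gay–Kirby trisection at a point of the
central surface, `IsGKTrisection.exists_jointChart`).  Then for some `ρ > 0` the map
`Φ(z) = Θ⁻¹(0, 0, ρ z)` on the closed disc `B̄(0, 2) ⊂ ℝ²` is a chart-like `2`-cell in `F` centred
at `x`: continuous, injective, `Φ(B̄(0,2)) ⊆ F ∩ Θ.source`, `Θ(Φ z) = (0, 0, ρ z)`, `Φ 0 = x`, and
`F ∩ O = Φ(B(0,2))` for the open `O = {y ∈ Θ.source | ‖(Θ y)₂₃‖ < 2ρ} ∋ x` — the input of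
`exists_datum_genus_zero_of_cell` / `GayKirby.sphereSector_exists_datum`, and the shape in which
the stabilisation step reads its drilling disc in a joint chart. [folklore] -/
theorem exists_chartCell_of_chart (Θ : OpenPartialHomeomorph X (EuclideanSpace ℝ (Fin 4)))
    {x : X} (hx : x ∈ Θ.source) (hΘx : Θ x = 0)
    (hΘF : ∀ y ∈ Θ.source, y ∈ F ↔ (Θ y 0 = 0 ∧ Θ y 1 = 0)) :
    ∃ (ρ : ℝ) (Φ : C(closedBall (0 : EuclideanSpace ℝ (Fin 2)) 2, X)) (O : Set X), 0 < ρ ∧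
      (∀ z, Φ z ∈ Θ.source) ∧
      (∀ z, Θ (Φ z) =
        !₂[0, 0, ρ * (z : EuclideanSpace ℝ (Fin 2)) 0, ρ * (z : EuclideanSpace ℝ (Fin 2)) 1]) ∧
      Φ ⟨0, by simp⟩ = x ∧ Injective Φ ∧ range Φ ⊆ F ∧ IsOpen O ∧ O ⊆ Θ.source ∧ x ∈ O ∧
      O = {y | y ∈ Θ.source ∧ ‖(!₂[Θ y 2, Θ y 3] : EuclideanSpace ℝ (Fin 2))‖ < 2 * ρ} ∧
      F ∩ O = Φ '' {z | ‖(z : EuclideanSpace ℝ (Fin 2))‖ < 2} := by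
  -- the coordinate plane `q₀ = q₁ = 0` and the projection onto it
  set emb : EuclideanSpace ℝ (Fin 2) → EuclideanSpace ℝ (Fin 4) :=
    fun w => !₂[0, 0, w 0, w 1] with hemb
  set pr : EuclideanSpace ℝ (Fin 4) → EuclideanSpace ℝ (Fin 2) := fun q => !₂[q 2, q 3] with hpr
  have hnorm : ∀ w, ‖emb w‖ = ‖w‖ := fun w => by
    simp [hemb, EuclideanSpace.norm_eq, Fin.sum_univ_four, Fin.sum_univ_two]
  have hpe : ∀ w, pr (emb w) = w := fun w => by
    ext i; fin_cases i <;> simp [hemb, hpr]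
  have hep : ∀ q : EuclideanSpace ℝ (Fin 4), q 0 = 0 → q 1 = 0 → emb (pr q) = q :=
    fun q h0 h1 => by ext i; fin_cases i <;> simp [hemb, hpr, h0, h1]
  have hembinj : Injective emb := fun v w h => by rw [← hpe v, ← hpe w, h]
  have hembc : Continuous emb := by
    have h2 : Continuous fun w : EuclideanSpace ℝ (Fin 2) => w 0 := PiLp.continuous_apply 2 _ 0
    have h3 : Continuous fun w : EuclideanSpace ℝ (Fin 2) => w 1 := PiLp.continuous_apply 2 _ 1
    refine (PiLp.continuous_toLp 2 (fun _ : Fin 4 => ℝ)).comp ?_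
    exact continuous_pi fun i => by
      fin_cases i
      · exact continuous_const
      · exact continuous_const
      · exact h2
      · exact h3
  have hprc : Continuous pr := by
    have h2 : Continuous fun q : EuclideanSpace ℝ (Fin 4) => q 2 := PiLp.continuous_apply 2 _ 2
    have h3 : Continuous fun q : EuclideanSpace ℝ (Fin 4) => q 3 := PiLp.continuous_apply 2 _ 3
    refine (PiLp.continuous_toLp 2 (fun _ : Fin 2 => ℝ)).comp ?_
    exact continuous_pi fun i => by
      fin_cases i
      · exact h2
      · exact h3
  -- a ball in the target
  obtain ⟨r, hr, hball⟩ := Metric.isOpen_iff.mp Θ.open_target 0 (hΘx ▸ Θ.map_source hx)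
  set ρ : ℝ := r / 3 with hρ
  have hρ0 : 0 < ρ := by positivity
  have htarget : ∀ z : closedBall (0 : EuclideanSpace ℝ (Fin 2)) 2,
      emb (ρ • (z : EuclideanSpace ℝ (Fin 2))) ∈ Θ.target := fun z => by
    apply hball
    rw [mem_ball_zero_iff, hnorm, norm_smul, Real.norm_of_nonneg hρ0.le]
    have hz : ‖(z : EuclideanSpace ℝ (Fin 2))‖ ≤ 2 := mem_closedBall_zero_iff.mp z.2
    nlinarith
  have hsmul : ∀ z : EuclideanSpace ℝ (Fin 2), emb (ρ • z) = !₂[0, 0, ρ * z 0, ρ * z 1] := fun z => by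
    ext i; fin_cases i <;> simp [hemb]
  -- the cell
  let Φ : C(closedBall (0 : EuclideanSpace ℝ (Fin 2)) 2, X) :=
    ⟨fun z => Θ.symm (emb (ρ • (z : EuclideanSpace ℝ (Fin 2)))),
      Θ.continuousOn_symm.comp_continuous
        (hembc.comp (continuous_subtype_val.const_smul ρ)) htarget⟩
  have hΦ : ∀ z, Φ z = Θ.symm (emb (ρ • (z : EuclideanSpace ℝ (Fin 2)))) := fun z => rfl
  have hΦsrc : ∀ z, Φ z ∈ Θ.source := fun z => by rw [hΦ]; exact Θ.map_target (htarget z)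
  have hΘΦ : ∀ z, Θ (Φ z) = emb (ρ • (z : EuclideanSpace ℝ (Fin 2))) := fun z => by
    rw [hΦ, Θ.right_inv (htarget z)]
  have hΦF : range Φ ⊆ F := by
    rintro y ⟨z, rfl⟩
    refine (hΘF _ (hΦsrc z)).2 ?_
    rw [hΘΦ]
    exact ⟨by simp [hemb], by simp [hemb]⟩
  have hΦinj : Injective Φ := fun z w h => by
    have h1 : emb (ρ • (z : EuclideanSpace ℝ (Fin 2))) = emb (ρ • (w : EuclideanSpace ℝ (Fin 2))) := by
      rw [← hΘΦ, ← hΘΦ, h]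
    have h2 := hembinj h1
    exact Subtype.ext (smul_right_injective _ hρ0.ne' h2)
  -- the open set
  set O : Set X := {y | y ∈ Θ.source ∧ ‖pr (Θ y)‖ < 2 * ρ} with hO
  have hOopen : IsOpen O := by
    have : O = Θ.source ∩ Θ ⁻¹' ((fun q => ‖pr q‖) ⁻¹' Iio (2 * ρ)) := by
      ext y; simp [hO]
    rw [this]
    exact Θ.isOpen_inter_preimage (isOpen_Iio.preimage (continuous_norm.comp hprc))
  have hxO : x ∈ O := by
    refine ⟨hx, ?_⟩
    rw [hΘx]
    have : pr 0 = 0 := by ext i; fin_cases i <;> simp [hpr]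
    rw [this, norm_zero]
    positivity
  refine ⟨ρ, Φ, O, hρ0, hΦsrc, fun z => (hΘΦ z).trans (hsmul _), ?_, hΦinj, hΦF, hOopen,
    fun y hy => hy.1, hxO, rfl, ?_⟩
  · rw [hΦ]
    simp only [smul_zero]
    have : emb 0 = 0 := by ext i; fin_cases i <;> simp [hemb]
    rw [this, ← hΘx, Θ.left_inv hx]
  · ext y
    constructor
    · rintro ⟨hyF, hysrc, hy⟩
      obtain ⟨h0, h1⟩ := (hΘF y hysrc).1 hyF
      have hq : emb (pr (Θ y)) = Θ y := hep _ h0 h1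
      set w : EuclideanSpace ℝ (Fin 2) := ρ⁻¹ • pr (Θ y) with hw
      have hw2 : ‖w‖ < 2 := by
        rw [hw, norm_smul, norm_inv, Real.norm_of_nonneg hρ0.le]
        rw [inv_mul_lt_iff₀ hρ0]
        linarith
      refine ⟨⟨w, mem_closedBall_zero_iff.mpr hw2.le⟩, hw2, ?_⟩
      rw [hΦ]
      change Θ.symm (emb (ρ • w)) = y
      rw [hw, smul_inv_smul₀ hρ0.ne', hq, Θ.left_inv hysrc]
    · rintro ⟨z, hz2, rfl⟩
      refine ⟨hΦF ⟨z, rfl⟩, hΦsrc z, ?_⟩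
      have hz2' : ‖(z : EuclideanSpace ℝ (Fin 2))‖ < 2 := hz2
      rw [hΘΦ, hpe, norm_smul, Real.norm_of_nonneg hρ0.le]
      nlinarith

variable [T2Space X] [ChartedSpace (EuclideanSpace ℝ (Fin 4)) X] [IsManifold (𝓡 4) ∞ X]
  {g : ℕ} {k : Fin 3 → ℕ} {S : Fin 3 → Set X}

/-- **Every point of the central surface of a Gay–Kirby trisection is the centre of a chart-like
`2`-cell of the central surface read in a joint chart** (`IsGKTrisection.exists_jointChart`
followed by `exists_chartCell_of_chart`): the drilling disc of a stabilisation, and the datum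
disc of `exists_datum_genus_zero_of_cell`, in the coordinates in which all three sectors are
linear. [cite: GayKirby2016, Def. 1 and Fig. 1; Def. 8] -/
theorem IsGKTrisection.exists_jointChart_cell (h : IsGKTrisection X g k S) {i j : Fin 3}
    (hji : j ≠ i) {x : X} (hx : x ∈ ⋂ l, S l) :
    ∃ (Θ : OpenPartialHomeomorph X (EuclideanSpace ℝ (Fin 4))) (l : Fin 3) (ρ : ℝ)
      (Φ : C(closedBall (0 : EuclideanSpace ℝ (Fin 2)) 2, X)) (O : Set X),
      Θ ∈ IsManifold.maximalAtlas (𝓡 4) ∞ X ∧ x ∈ Θ.source ∧ Θ x = 0 ∧ l ≠ i ∧ l ≠ j ∧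
      (∀ y ∈ Θ.source, y ∈ S i ↔ (0 ≤ Θ y 0 ∧ 0 ≤ Θ y 1)) ∧
      (∀ y ∈ Θ.source, y ∈ (⋂ m, S m) ↔ (Θ y 0 = 0 ∧ Θ y 1 = 0)) ∧
      (∀ y ∈ Θ.source, y ∈ S j ↔ (Θ y 0 ≤ 0 ∧ Θ y 0 ≤ Θ y 1)) ∧
      (∀ y ∈ Θ.source, y ∈ S l ↔ (Θ y 1 ≤ 0 ∧ Θ y 1 ≤ Θ y 0)) ∧
      0 < ρ ∧ (∀ z, Φ z ∈ Θ.source) ∧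
      (∀ z, Θ (Φ z) =
        !₂[0, 0, ρ * (z : EuclideanSpace ℝ (Fin 2)) 0, ρ * (z : EuclideanSpace ℝ (Fin 2)) 1]) ∧
      Φ ⟨0, by simp⟩ = x ∧ Injective Φ ∧ range Φ ⊆ (⋂ m, S m) ∧ IsOpen O ∧ O ⊆ Θ.source ∧ x ∈ O ∧
      O = {y | y ∈ Θ.source ∧ ‖(!₂[Θ y 2, Θ y 3] : EuclideanSpace ℝ (Fin 2))‖ < 2 * ρ} ∧
      (⋂ m, S m) ∩ O = Φ '' {z | ‖(z : EuclideanSpace ℝ (Fin 2))‖ < 2} := by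
  obtain ⟨Θ, l, hΘ, hxs, hΘx, hli, hlj, hSi, hF, hSj, hSl⟩ := h.exists_jointChart hji hx
  obtain ⟨ρ, Φ, O, hρ, h1, h2, h3, h4, h5, h6, h7, h8, h9, h10⟩ := exists_chartCell_of_chart Θ hxs hΘx hF
  exact ⟨Θ, l, ρ, Φ, O, hΘ, hxs, hΘx, hli, hlj, hSi, hF, hSj, hSl, hρ, h1, h2, h3, h4, h5, h6, h7, h8,
    h9, h10⟩

end ChartCell

/-! ### The central `2`-sphere of Gay–Kirby's genus-`0` trisection of `S⁴` -/

namespace GayKirby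

/-- The central surface `{z = 0} ∩ S⁴` of the genus-`0` trisection of `S⁴` is closed.
[cite: GayKirby2016, §2 (arXiv p. 5), first example] -/
theorem isClosed_iInter_sphereSector : IsClosed (⋂ j, sphereSector j) := by
  rw [iInter_sphereSector_eq]
  have hc : ∀ i : Fin 5, Continuous fun x : Metric.sphere (0 : EuclideanSpace ℝ (Fin 5)) 1 =>
      (x : EuclideanSpace ℝ (Fin 5)) i := fun i =>
    (PiLp.continuous_apply 2 (fun _ : Fin 5 => ℝ) i).comp continuous_subtype_val
  exact (isClosed_eq (hc 0) continuous_const).inter (isClosed_eq (hc 1) continuous_const)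

/-- The isometric embedding `ℝ³ → ℝ⁵ = ℂ × ℝ³`, `y ↦ (0, 0, y)` (local copy of the private
`tailEmb` of `SphereTrisections.lean`). [folklore] -/
private theorem isometry_tail3 :
    Isometry (fun y : EuclideanSpace ℝ (Fin 3) => (!₂[0, 0, y 0, y 1, y 2] : EuclideanSpace ℝ (Fin 5))) :=
  Isometry.of_dist_eq fun x y => by
    simp [EuclideanSpace.dist_eq, Fin.sum_univ_five, Fin.sum_univ_three]

/-- The image of `S² ∖ {q}` under `y ↦ (0, 0, y)` is `({z = 0} ∩ S⁴) ∖ {(0, 0, q)}`, read in `ℝ⁵`.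
[folklore] -/
private theorem image_tail3_sphere_diff (q : EuclideanSpace ℝ (Fin 3)) :
    (fun y : EuclideanSpace ℝ (Fin 3) => (!₂[0, 0, y 0, y 1, y 2] : EuclideanSpace ℝ (Fin 5))) ''
        (Metric.sphere (0 : EuclideanSpace ℝ (Fin 3)) 1 \ {q}) =
      {v | v ∈ Metric.sphere (0 : EuclideanSpace ℝ (Fin 5)) 1 ∧ v 0 = 0 ∧ v 1 = 0} \
        {!₂[0, 0, q 0, q 1, q 2]} := by
  have hn : ∀ y : EuclideanSpace ℝ (Fin 3),
      ‖(!₂[0, 0, y 0, y 1, y 2] : EuclideanSpace ℝ (Fin 5))‖ = ‖y‖ := fun y => by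
    simp [EuclideanSpace.norm_eq, Fin.sum_univ_five, Fin.sum_univ_three]
  ext v
  simp only [mem_image, mem_sdiff, mem_sphere_iff_norm, sub_zero, mem_singleton_iff, mem_setOf_eq]
  constructor
  · rintro ⟨y, ⟨hy, hyq⟩, rfl⟩
    refine ⟨⟨by rw [hn, hy], by simp, by simp⟩, fun h => hyq ?_⟩
    ext i
    fin_cases i
    · simpa using congrArg (fun w : EuclideanSpace ℝ (Fin 5) => w 2) h
    · simpa using congrArg (fun w : EuclideanSpace ℝ (Fin 5) => w 3) h
    · simpa using congrArg (fun w : EuclideanSpace ℝ (Fin 5) => w 4) h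
  · rintro ⟨⟨hv, h0, h1⟩, hvq⟩
    set y₀ : EuclideanSpace ℝ (Fin 3) := !₂[v 2, v 3, v 4] with hy₀
    have hTy : (!₂[0, 0, y₀ 0, y₀ 1, y₀ 2] : EuclideanSpace ℝ (Fin 5)) = v := by
      ext i
      fin_cases i <;> simp [hy₀, h0, h1]
    refine ⟨y₀, ⟨?_, fun h => hvq ?_⟩, hTy⟩
    · rw [← hn y₀, hTy, hv]
    · rw [← hTy, h]

/-- **The central `2`-sphere minus a point is simply connected**: `({z = 0} ∩ S⁴) ∖ {p}` is the
isometric image of `S² ∖ {q} ⊂ ℝ³`, and the complement of a point in `S²` is simply connected by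
stereographic projection (Hatcher, Prop. 1.14). [cite: HatcherAT2002, Prop. 1.14 (p. 35)] -/
theorem isSimplyConnected_iInter_sphereSector_diff_singleton
    (p : Metric.sphere (0 : EuclideanSpace ℝ (Fin 5)) 1) (hp : p ∈ ⋂ j, sphereSector j) :
    IsSimplyConnected ((⋂ j, sphereSector j) \ {p}) := by
  obtain ⟨h0, h1⟩ := eq_zero_of_forall_mem_sphereSector (mem_iInter.1 hp)
  -- the point `q ∈ S²` under `p = (0, 0, q)`
  set q : EuclideanSpace ℝ (Fin 3) := !₂[(p : EuclideanSpace ℝ (Fin 5)) 2,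
    (p : EuclideanSpace ℝ (Fin 5)) 3, (p : EuclideanSpace ℝ (Fin 5)) 4] with hq
  have hpq : (!₂[0, 0, q 0, q 1, q 2] : EuclideanSpace ℝ (Fin 5)) = p := by
    ext i
    fin_cases i <;> simp [hq, h0, h1]
  have hq1 : q ∈ Metric.sphere (0 : EuclideanSpace ℝ (Fin 3)) 1 := by
    have hn : ‖(!₂[0, 0, q 0, q 1, q 2] : EuclideanSpace ℝ (Fin 5))‖ = ‖q‖ := by
      simp [EuclideanSpace.norm_eq, Fin.sum_univ_five, Fin.sum_univ_three]
    rw [mem_sphere_zero_iff_norm, ← hn, hpq]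
    exact norm_eq_of_mem_sphere p
  -- `S² ∖ {q}` is simply connected (stereographic projection), read in `ℝ³`
  have h3 : IsSimplyConnected (Metric.sphere (0 : EuclideanSpace ℝ (Fin 3)) 1 \ {q}) := by
    have h := Literature.AlgebraicTopology.FundamentalGroup.isSimplyConnected_compl_singleton_sphere
      (E := EuclideanSpace ℝ (Fin 3)) ⟨q, hq1⟩
    rw [← Topology.IsEmbedding.subtypeVal.isSimplyConnected_image] at h
    have hset : Subtype.val '' ({⟨q, hq1⟩}ᶜ : Set (Metric.sphere (0 : EuclideanSpace ℝ (Fin 3)) 1)) =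
        Metric.sphere (0 : EuclideanSpace ℝ (Fin 3)) 1 \ {q} := by
      refine Set.ext fun y => ⟨?_, ?_⟩
      · rintro ⟨w, hw, rfl⟩
        exact ⟨w.2, fun h => hw (Subtype.ext h)⟩
      · rintro ⟨hy, hyq⟩
        exact ⟨⟨y, hy⟩, fun h => hyq (congrArg Subtype.val h), rfl⟩
    rwa [hset] at h
  -- push it into `ℝ⁵` and pull it back to `S⁴`
  have h5 := (isometry_tail3.isEmbedding.isSimplyConnected_image).2 h3
  rw [image_tail3_sphere_diff q, hpq] at h5
  rw [← Topology.IsEmbedding.subtypeVal.isSimplyConnected_image, image_sdiff Subtype.val_injective,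
    image_singleton, image_val_iInter_sphereSector]
  exact h5

/-- **Base case of the datum induction for (d′): a disc in the central `2`-sphere of the
genus-`0` trisection of `S⁴`.**  Let `Φ : B̄(0,2) ⊂ ℝ² → S⁴` be continuous and injective with
image in the central surface `F = ⋂ⱼ Xⱼ = {z = 0} ∩ S⁴` of Gay–Kirby's genus-`0` trisection and
`F ∩ O = Φ(B(0,2))` for an open `O ⊆ S⁴` (any coordinate disc of the round `2`-sphere), and let
`x₀ ∈ C = Φ(‖z‖ = 1)`.  With `A = F ∖ Φ(B(0,1))`, `C_A = Φ(1 ≤ ‖z‖ < 2)`: `A` is closed,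
`C ⊆ A ⊆ F`, `C_A = A ∩ O ⊇ C` strong deformation retracts onto `C`, `A` is simply connected and
path connected, `C` is path connected, `π₁(C, x₀) = ⟨t⟩`, and for the trivial free basis
`θ_A : F⟨∅⟩ ≃* π₁(A, x₀) = 1` and the marking `μ₀ : S_0 = 1 ≃* π₁(F, x₀) = 1` (Abrams–Gay–Kirby,
Thm. 5: "The unique `(0,0)`-trisection of `{1}` maps to the unique `(0,0)`-trisection of `S⁴`")
one has `θ_A(r_0) = t` read in `A` and `μ₀ ∘ mk = (A ⊆ F)_* ∘ θ_A` — the complete old-surface input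
`hA … hμ₀` of `exists_marking_groupGKTrisectionOf_eq_stabilize_datum` at `g = 0` for the marked
trisection `(GayKirby.sphereSector, x₀, μ₀)`, i.e. the `base` of
`sphere_gkTrisections_of_invariant_step` for the invariant "carries a free-basis datum"
(together with `sphereSector_isBalancedGKTrisection_holds`).
[cite: GayKirby2016, §2 (arXiv p. 5), first example; Def. 8 and Lemma 10 (p. 3100)]
[cite: AbramsGayKirby2018, Thm. 5 (p. 1541)] -/
theorem sphereSector_exists_datum
    (Φ : C(closedBall (0 : EuclideanSpace ℝ (Fin 2)) 2, Metric.sphere (0 : EuclideanSpace ℝ (Fin 5)) 1))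
    (hinj : Injective Φ) (hΦF : range Φ ⊆ ⋂ j, sphereSector j)
    {O : Set (Metric.sphere (0 : EuclideanSpace ℝ (Fin 5)) 1)} (hO : IsOpen O)
    (hFO : (⋂ j, sphereSector j) ∩ O = Φ '' {z | ‖(z : EuclideanSpace ℝ (Fin 2))‖ < 2})
    {x₀ : Metric.sphere (0 : EuclideanSpace ℝ (Fin 5)) 1}
    (hx₀ : x₀ ∈ Φ '' {z | ‖(z : EuclideanSpace ℝ (Fin 2))‖ = 1}) :
    ∃ (_hA : IsClosed ((⋂ j, sphereSector j) \ Φ '' {z | ‖(z : EuclideanSpace ℝ (Fin 2))‖ < 1}))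
      (hCA : Φ '' {z | ‖(z : EuclideanSpace ℝ (Fin 2))‖ = 1} ⊆
        (⋂ j, sphereSector j) \ Φ '' {z | ‖(z : EuclideanSpace ℝ (Fin 2))‖ < 1})
      (_hCAe : Φ '' {z | 1 ≤ ‖(z : EuclideanSpace ℝ (Fin 2))‖ ∧ ‖(z : EuclideanSpace ℝ (Fin 2))‖ < 2} =
        ((⋂ j, sphereSector j) \ Φ '' {z | ‖(z : EuclideanSpace ℝ (Fin 2))‖ < 1}) ∩ O)
      (_hCCA : Φ '' {z | ‖(z : EuclideanSpace ℝ (Fin 2))‖ = 1} ⊆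
        Φ '' {z | 1 ≤ ‖(z : EuclideanSpace ℝ (Fin 2))‖ ∧ ‖(z : EuclideanSpace ℝ (Fin 2))‖ < 2})
      (_hsdrCA : IsStrongDeformationRetractOf (Φ '' {z | ‖(z : EuclideanSpace ℝ (Fin 2))‖ = 1})
        (Φ '' {z | 1 ≤ ‖(z : EuclideanSpace ℝ (Fin 2))‖ ∧ ‖(z : EuclideanSpace ℝ (Fin 2))‖ < 2}))
      (_hAsc : IsSimplyConnected ((⋂ j, sphereSector j) \ Φ '' {z | ‖(z : EuclideanSpace ℝ (Fin 2))‖ < 1}))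
      (_hApc : IsPathConnected ((⋂ j, sphereSector j) \ Φ '' {z | ‖(z : EuclideanSpace ℝ (Fin 2))‖ < 1}))
      (_hCpc : IsPathConnected (Φ '' {z | ‖(z : EuclideanSpace ℝ (Fin 2))‖ = 1}))
      (hAF : (⋂ j, sphereSector j) \ Φ '' {z | ‖(z : EuclideanSpace ℝ (Fin 2))‖ < 1} ⊆ ⋂ j, sphereSector j)
      (t : FundamentalGroup ↥(Φ '' {z | ‖(z : EuclideanSpace ℝ (Fin 2))‖ = 1}) ⟨x₀, hx₀⟩)
      (θA : FreeGroup (surfaceGen 0) ≃*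
        FundamentalGroup ↥((⋂ j, sphereSector j) \ Φ '' {z | ‖(z : EuclideanSpace ℝ (Fin 2))‖ < 1})
          ⟨x₀, hCA hx₀⟩)
      (μ₀ : SurfaceGroup 0 ≃* FundamentalGroup (centralSurface sphereSector) ⟨x₀, hAF (hCA hx₀)⟩),
      Subgroup.closure {t} = ⊤ ∧
      θA (surfaceRelator 0) = inclHomOfSubset hCA x₀ hx₀ (hCA hx₀) t ∧
      μ₀.toMonoidHom.comp (PresentedGroup.mk _) =
        (inclHomOfSubset hAF x₀ (hCA hx₀) (hAF (hCA hx₀))).comp θA.toMonoidHom := by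
  have hF0 : IsSimplyConnected ((⋂ j, sphereSector j) \ {Φ ⟨0, by simp⟩}) :=
    isSimplyConnected_iInter_sphereSector_diff_singleton _ (hΦF (mem_range_self _))
  obtain ⟨hA, hCA, hCAe, hCCA, hsdr, hAsc, hApc, hCpc, hAF, hFsc, t, θA, ht, hθA, hμ⟩ :=
    exists_datum_genus_zero_of_cell isClosed_iInter_sphereSector Φ hinj hΦF hO hFO hF0 hx₀
  letI : Unique (SurfaceGroup 0) := uniqueOfSubsingleton 1
  letI : Unique (FundamentalGroup (centralSurface sphereSector) ⟨x₀, hAF (hCA hx₀)⟩) :=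
    uniqueOfSubsingleton 1
  exact ⟨hA, hCA, hCAe, hCCA, hsdr, hAsc, hApc, hCpc, hAF, t, θA, MulEquiv.ofUnique, ht, hθA,
    hμ MulEquiv.ofUnique⟩

/-- **The base case of the datum induction for (d′), unconditionally and in joint-chart form.**
At every point `x` of the central `2`-sphere of Gay–Kirby's genus-`0` trisection of `S⁴`
(`sphereSector_isBalancedGKTrisection_holds`) and for every ordered pair of sectors `i ≠ j`
there are a joint chart `Θ` (all three sectors linear, `F = {q₀ = q₁ = 0}`), a radius `ρ > 0`
and the chart-like `2`-cell `Φ(z) = Θ⁻¹(0, 0, ρ z)` centred at `x`, and — with the base point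
`x₀ = Φ(1, 0)` on its boundary circle — the complete genus-`0` datum of
`sphereSector_exists_datum` (`A = F ∖ Φ(B(0,1))` closed, simply connected, path connected;
`C = Φ(S¹) ⊆ A` path connected with collar `Φ(1 ≤ r < 2) = A ∩ O` strong deformation retracting
onto it; `π₁(C, x₀) = ⟨t⟩`; `θ_A`, `μ₀` with `θ_A(r_0) = t` and `μ₀ ∘ mk = (A ⊆ F)_* ∘ θ_A`).  This
is the `base` of `sphere_gkTrisections_of_invariant_step` for the invariant "the marking reads
through a free-basis datum whose disc is round in a joint chart".
[cite: GayKirby2016, §2 (arXiv p. 5), first example; Def. 8 and Lemma 10 (p. 3100)]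
[cite: AbramsGayKirby2018, Thm. 5 (p. 1541)] -/
theorem sphereSector_exists_jointChart_datum {i j : Fin 3} (hji : j ≠ i)
    {x : Metric.sphere (0 : EuclideanSpace ℝ (Fin 5)) 1} (hx : x ∈ ⋂ m, sphereSector m) :
    ∃ (Θ : OpenPartialHomeomorph (Metric.sphere (0 : EuclideanSpace ℝ (Fin 5)) 1)
        (EuclideanSpace ℝ (Fin 4))) (l : Fin 3) (ρ : ℝ)
      (Φ : C(closedBall (0 : EuclideanSpace ℝ (Fin 2)) 2, Metric.sphere (0 : EuclideanSpace ℝ (Fin 5)) 1))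
      (O : Set (Metric.sphere (0 : EuclideanSpace ℝ (Fin 5)) 1)),
      (Θ ∈ IsManifold.maximalAtlas (𝓡 4) ∞ (Metric.sphere (0 : EuclideanSpace ℝ (Fin 5)) 1) ∧
        x ∈ Θ.source ∧ Θ x = 0 ∧ l ≠ i ∧ l ≠ j ∧
        (∀ y ∈ Θ.source, y ∈ sphereSector i ↔ (0 ≤ Θ y 0 ∧ 0 ≤ Θ y 1)) ∧
        (∀ y ∈ Θ.source, y ∈ (⋂ m, sphereSector m) ↔ (Θ y 0 = 0 ∧ Θ y 1 = 0)) ∧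
        (∀ y ∈ Θ.source, y ∈ sphereSector j ↔ (Θ y 0 ≤ 0 ∧ Θ y 0 ≤ Θ y 1)) ∧
        (∀ y ∈ Θ.source, y ∈ sphereSector l ↔ (Θ y 1 ≤ 0 ∧ Θ y 1 ≤ Θ y 0)) ∧
        0 < ρ ∧ (∀ z, Φ z ∈ Θ.source) ∧
        (∀ z, Θ (Φ z) =
          !₂[0, 0, ρ * (z : EuclideanSpace ℝ (Fin 2)) 0, ρ * (z : EuclideanSpace ℝ (Fin 2)) 1]) ∧
        Φ ⟨0, by simp⟩ = x ∧ Injective Φ ∧ range Φ ⊆ (⋂ m, sphereSector m) ∧ IsOpen O ∧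
        O ⊆ Θ.source ∧ x ∈ O ∧
        O = {y | y ∈ Θ.source ∧ ‖(!₂[Θ y 2, Θ y 3] : EuclideanSpace ℝ (Fin 2))‖ < 2 * ρ} ∧
        (⋂ m, sphereSector m) ∩ O = Φ '' {z | ‖(z : EuclideanSpace ℝ (Fin 2))‖ < 2}) ∧
      ∃ (hx₀ : Φ ⟨Complex.orthonormalBasisOneI.repr 1,
            closedBall_subset_closedBall one_le_two (by simp)⟩ ∈
          Φ '' {z | ‖(z : EuclideanSpace ℝ (Fin 2))‖ = 1})
        (_hA : IsClosed ((⋂ m, sphereSector m) \ Φ '' {z | ‖(z : EuclideanSpace ℝ (Fin 2))‖ < 1}))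
        (hCA : Φ '' {z | ‖(z : EuclideanSpace ℝ (Fin 2))‖ = 1} ⊆
          (⋂ m, sphereSector m) \ Φ '' {z | ‖(z : EuclideanSpace ℝ (Fin 2))‖ < 1})
        (_hCAe : Φ '' {z | 1 ≤ ‖(z : EuclideanSpace ℝ (Fin 2))‖ ∧ ‖(z : EuclideanSpace ℝ (Fin 2))‖ < 2} =
          ((⋂ m, sphereSector m) \ Φ '' {z | ‖(z : EuclideanSpace ℝ (Fin 2))‖ < 1}) ∩ O)
        (_hCCA : Φ '' {z | ‖(z : EuclideanSpace ℝ (Fin 2))‖ = 1} ⊆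
          Φ '' {z | 1 ≤ ‖(z : EuclideanSpace ℝ (Fin 2))‖ ∧ ‖(z : EuclideanSpace ℝ (Fin 2))‖ < 2})
        (_hsdrCA : IsStrongDeformationRetractOf (Φ '' {z | ‖(z : EuclideanSpace ℝ (Fin 2))‖ = 1})
          (Φ '' {z | 1 ≤ ‖(z : EuclideanSpace ℝ (Fin 2))‖ ∧ ‖(z : EuclideanSpace ℝ (Fin 2))‖ < 2}))
        (_hAsc : IsSimplyConnected ((⋂ m, sphereSector m) \ Φ '' {z | ‖(z : EuclideanSpace ℝ (Fin 2))‖ < 1}))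
        (_hApc : IsPathConnected ((⋂ m, sphereSector m) \ Φ '' {z | ‖(z : EuclideanSpace ℝ (Fin 2))‖ < 1}))
        (_hCpc : IsPathConnected (Φ '' {z | ‖(z : EuclideanSpace ℝ (Fin 2))‖ = 1}))
        (hAF : (⋂ m, sphereSector m) \ Φ '' {z | ‖(z : EuclideanSpace ℝ (Fin 2))‖ < 1} ⊆
          ⋂ m, sphereSector m)
        (t : FundamentalGroup ↥(Φ '' {z | ‖(z : EuclideanSpace ℝ (Fin 2))‖ = 1}) ⟨_, hx₀⟩)
        (θA : FreeGroup (surfaceGen 0) ≃*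
          FundamentalGroup ↥((⋂ m, sphereSector m) \ Φ '' {z | ‖(z : EuclideanSpace ℝ (Fin 2))‖ < 1})
            ⟨_, hCA hx₀⟩)
        (μ₀ : SurfaceGroup 0 ≃* FundamentalGroup (centralSurface sphereSector) ⟨_, hAF (hCA hx₀)⟩),
        Subgroup.closure {t} = ⊤ ∧
        θA (surfaceRelator 0) = inclHomOfSubset hCA _ hx₀ (hCA hx₀) t ∧
        μ₀.toMonoidHom.comp (PresentedGroup.mk _) =
          (inclHomOfSubset hAF _ (hCA hx₀) (hAF (hCA hx₀))).comp θA.toMonoidHom := by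
  have h0 : IsGKTrisection (Metric.sphere (0 : EuclideanSpace ℝ (Fin 5)) 1) 0 (fun _ => 0) sphereSector :=
    sphereSector_isBalancedGKTrisection_holds
  obtain ⟨Θ, l, ρ, Φ, O, hΘ, hxs, hΘx, hli, hlj, hSi, hF, hSj, hSl, hρ, h1, h2, h3, hinj, hΦF, hO, h7,
    h8, h9, hFO⟩ := h0.exists_jointChart_cell hji hx
  have hx₀ : Φ ⟨Complex.orthonormalBasisOneI.repr 1, closedBall_subset_closedBall one_le_two (by simp)⟩ ∈
      Φ '' {z | ‖(z : EuclideanSpace ℝ (Fin 2))‖ = 1} :=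
    ⟨_, by simp, rfl⟩
  obtain ⟨hA, hCA, hCAe, hCCA, hsdr, hAsc, hApc, hCpc, hAF, t, θA, μ₀, ht, hθA, hμ⟩ :=
    sphereSector_exists_datum Φ hinj hΦF hO hFO hx₀
  exact ⟨Θ, l, ρ, Φ, O, ⟨hΘ, hxs, hΘx, hli, hlj, hSi, hF, hSj, hSl, hρ, h1, h2, h3, hinj, hΦF, hO, h7,
    h8, h9, hFO⟩, hx₀, hA, hCA, hCAe, hCCA, hsdr, hAsc, hApc, hCpc, hAF, t, θA, μ₀, ht, hθA, hμ⟩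

end GayKirby

end Literature.Topology.FourManifolds
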